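import Summits.Schanuel.Schanuel.Theorems.RootDecomp1KTorsionEndgame

/-!
# RootDecomp1KTorsionIndependence — §21 REV C «TORSION CELLS» port, part 4/5 (lens 6, gen 10 = ROUND 5 theorem round of route-Schanuel-RootDecomp1K on A₄ʰ stmt-Schanuel-33363)

Mechanical port (census-1 gen 8; tools tools/build_dark.py over census/tools/gen7/portkit2.py) of §21 of HOME/decomp-schanuel-lens-6/g10/addendum/TorsionCells.lean v2 (= scratch/Tor21.lean without its copied toolkit)
(sha256 b430567a…, 9025 l; critic VERDICT 2026-08-30T16:25:54Z ACCEPTED — amended F2⁗-1K (i) MET by the sub-class «torsion anchor»; census C-6) on top of the §17 wave Theorems/RootDecomp1KHyper01…19.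
This part: node lines 8549–8786 (2 declarations: torsion_aeval_ne_zero, algebraicIndependent_torsion).
No named fact, no hypothesis (only tree-proved inputs);
statements and proofs
are otherwise the node's verbatim, in the wave namespace `Summit.Schanuel.Schanuel.Theorems.RootDecomp1KHyper` (sub-namespace `HyperCell`).
`--supports stmt-Schanuel-33363` (A₄ʰ HyperLiouvilleSchanuel: HYPOTHESIS-FREE decided n = 3 cells (2πi, ρ·2πi, w) and every torsion anchor s·πi (ρ hyper-Liouville), via algebraicIndependent_torsion — only input the tree-proved NW96 Thm 2(2) measure of π). Sorry-free; standard axioms. Nothing here proves Schanuel; rung 0.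
-/

set_option linter.dupNamespace false
set_option linter.unusedSectionVars false

noncomputable section

open Complex IntermediateField Filter Polynomial

namespace Summit.Schanuel.Schanuel.Theorems.RootDecomp1KHyper

variable {n K : ℕ}

namespace HyperCell

variable {n K : ℕ}

/-- §21h. Length and height bookkeeping: auxiliary statement `len_le_two_pow_mul_mahlerMeasure` (lens 6 gen 10 node, ported verbatim). -/
private theorem len_le_two_pow_mul_mahlerMeasure (S : ℤ[X]) :
    (len S : ℝ) ≤ 2 ^ S.natDegree * (S.map (Int.castRingHom ℂ)).mahlerMeasure := by
  have hdeg : (S.map (Int.castRingHom ℂ)).natDegree = S.natDegree :=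
    natDegree_map_eq_of_injective (RingHom.injective_int _) S
  unfold len
  push_cast
  calc ∑ k ∈ Finset.range (S.natDegree + 1), |((S.coeff k : ℤ) : ℝ)|
      = ∑ k ∈ Finset.range (S.natDegree + 1), ‖(S.map (Int.castRingHom ℂ)).coeff k‖ := by
        refine Finset.sum_congr rfl fun k _ => ?_
        rw [Polynomial.coeff_map, eq_intCast, Complex.norm_intCast]
    _ ≤ ∑ k ∈ Finset.range (S.natDegree + 1),
          ((S.natDegree.choose k : ℕ) : ℝ) * (S.map (Int.castRingHom ℂ)).mahlerMeasure := by
        refine Finset.sum_le_sum fun k _ => ?_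
        have := norm_coeff_le_choose_mul_mahlerMeasure k (S.map (Int.castRingHom ℂ))
        rwa [hdeg] at this
    _ = 2 ^ S.natDegree * (S.map (Int.castRingHom ℂ)).mahlerMeasure := by
        rw [← Finset.sum_mul]
        congr 1
        exact_mod_cast Nat.sum_range_choose S.natDegree

set_option maxHeartbeats 1600000 in
/-- **Torsion extraction.** For a hyper-Liouville real `ρ`, the numbers `ρ, π, e^{2πiρ}` satisfy no
non-trivial integer polynomial relation.  PROOF: a relation `P(ρ, π, E) = 0` is specialised at a
super-approximant `p/q` of `ρ`, where `e^{2πi p/q}` is a primitive `q`-th root of unity `y`: the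
eliminant `S = Res_X(Φ_q(X), q^D P(p/q, T, X)) ∈ ℤ[T] ∖ 0` (non-zero once `φ(q) > deg_E P` and `q`
exceeds the rational-root denominators of a slice of `P`, §21d) has `S(π) = ∏_b q^D P(p/q, π, b)` over
the primitive `q`-th roots `b`; the factor `b = y` is `≤ q^D · Kl · |ρ − p/q| < q^D Kl e^{−q^m}`, the
others `≤ q^D B`, while `deg S ≤ qK`, `log L(S) ≪ q²` and the PROVED transcendence measure of `π`
(NW 1996 Thm 2 (2)) give `|S(π)| ≥ exp(−A₃ q⁴)` — impossible for `m ≥ 7`, `q` large. -/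
theorem torsion_aeval_ne_zero {ρ : ℝ} (hρ : HyperLiouville ρ) (P : MvPolynomial (Fin 3) ℤ)
    (hP : P ≠ 0) :
    MvPolynomial.aeval ![(ρ : ℂ), (Real.pi : ℂ), cexp (2 * Real.pi * I * ρ)] P ≠ 0 := by
  classical
  intro hP0
  -- data of `P`
  have hsupp : P.support.Nonempty :=
    Finset.nonempty_iff_ne_empty.mpr fun h => hP (MvPolynomial.support_eq_empty.mp h)
  obtain ⟨s₀, hs₀⟩ := hsupp
  obtain ⟨D, hDdef⟩ : ∃ D : ℕ, D = P.support.sup (fun s => s 0) := ⟨_, rfl⟩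
  obtain ⟨K, hKdef⟩ : ∃ K : ℕ, K = P.support.sup (fun s => s 1) := ⟨_, rfl⟩
  obtain ⟨N, hNdef⟩ : ∃ N : ℕ, N = P.support.sup (fun s => s 2) := ⟨_, rfl⟩
  have hD : ∀ s ∈ P.support, s 0 ≤ D := fun s hs =>
    hDdef ▸ Finset.le_sup (f := fun s : Fin 3 →₀ ℕ => s 0) hs
  have hK : ∀ s ∈ P.support, s 1 ≤ K := fun s hs =>
    hKdef ▸ Finset.le_sup (f := fun s : Fin 3 →₀ ℕ => s 1) hs
  have hN : ∀ s ∈ P.support, s 2 ≤ N := fun s hs =>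
    hNdef ▸ Finset.le_sup (f := fun s : Fin 3 →₀ ℕ => s 2) hs
  obtain ⟨Kl, δ₁, hKl0, hδ₁, hlip⟩ := exists_lipschitz_torF P ρ
  have hFρ : torF P ρ = 0 := by rw [torF_eq_aeval]; exact hP0
  -- constants
  obtain ⟨B, hB⟩ : ∃ B : ℝ, B = ∑ s ∈ P.support,
      ((|P.coeff s| : ℤ) : ℝ) * ((|ρ| + 1) ^ (s 0) * 4 ^ (s 1) * 1 ^ (s 2)) := ⟨_, rfl⟩
  have hB0 : 0 ≤ B := by
    rw [hB]; exact Finset.sum_nonneg fun s _ => by positivity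
  obtain ⟨B', hB'⟩ : ∃ B' : ℝ, B' = max 1 B := ⟨_, rfl⟩
  have hB'1 : 1 ≤ B' := hB' ▸ le_max_left _ _
  have hBB' : B ≤ B' := hB' ▸ le_max_right _ _
  obtain ⟨A, hA⟩ : ∃ A : ℝ,
      A = ((K : ℝ) + 1) * (((N : ℝ) + 1) * ((cP P : ℝ) * (|ρ| + 2) ^ D)) := ⟨_, rfl⟩
  have hcP1 : (1 : ℝ) ≤ cP P := by exact_mod_cast one_le_cP hs₀
  have hK0 : (0 : ℝ) ≤ K := Nat.cast_nonneg K
  have hN0 : (0 : ℝ) ≤ N := Nat.cast_nonneg N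
  have hD0 : (0 : ℝ) ≤ D := Nat.cast_nonneg D
  have hA1 : 1 ≤ A := by
    rw [hA]
    have h3 : (1 : ℝ) ≤ (|ρ| + 2) ^ D := one_le_pow₀ (by linarith [abs_nonneg ρ])
    calc (1 : ℝ) = 1 * (1 * (1 * 1)) := by ring
      _ ≤ ((K : ℝ) + 1) * (((N : ℝ) + 1) * ((cP P : ℝ) * (|ρ| + 2) ^ D)) := by
          gcongr <;> linarith
  obtain ⟨A₁, hA₁⟩ : ∃ A₁ : ℝ, A₁ = 2 * D + B' + Kl + 1 := ⟨_, rfl⟩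
  obtain ⟨A₂, hA₂⟩ : ∃ A₂ : ℝ, A₂ = 2 + ((K : ℝ) + 1) + A + D := ⟨_, rfl⟩
  obtain ⟨A₃, hA₃⟩ : ∃ A₃ : ℝ,
      A₃ = 4 * 10 ^ 6 * ((K : ℝ) + 1) ^ 2 * (A₂ + ((K : ℝ) + 1) ^ 2) := ⟨_, rfl⟩
  have hA₁0 : 0 ≤ A₁ := by rw [hA₁]; linarith
  have hA₂0 : 0 ≤ A₂ := by rw [hA₂]; linarith
  have hA₃0 : 0 ≤ A₃ := by rw [hA₃]; positivity
  -- threshold and the super-approximant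
  obtain ⟨q₀, hq₀def⟩ : ∃ q₀ : ℕ, q₀ = max (max (max 3 (denBound (torD P (s₀ 1) (s₀ 2))))
      (max (2 * (N + 1) ^ 2) (⌈1 / δ₁⌉₊ + 1))) (⌈A₁ + A₃⌉₊ + 1) := ⟨_, rfl⟩
  obtain ⟨r, hden, hρr, hη⟩ := hρ (max 7 q₀)
  have hq₀q : q₀ ≤ r.den := le_trans (le_max_right _ _) hden
  have hq7 : 7 ≤ max 7 q₀ := le_max_left _ _
  have hqden : denBound (torD P (s₀ 1) (s₀ 2)) ≤ r.den := by rw [hq₀def] at hq₀q; omega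
  have hqN : 2 * (N + 1) ^ 2 ≤ r.den := by rw [hq₀def] at hq₀q; omega
  have hqδ : ⌈1 / δ₁⌉₊ + 1 ≤ r.den := by rw [hq₀def] at hq₀q; omega
  have hqA : ⌈A₁ + A₃⌉₊ + 1 ≤ r.den := by rw [hq₀def] at hq₀q; omega
  have hqpos : 0 < r.den := r.den_pos
  have hq0 : r.den ≠ 0 := r.den_nz
  obtain ⟨Q, hQ⟩ : ∃ Q : ℝ, Q = (r.den : ℝ) := ⟨_, rfl⟩
  have hQ1 : (1 : ℝ) ≤ Q := by rw [hQ]; exact_mod_cast hqpos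
  have hQ0 : (0 : ℝ) < Q := by linarith
  -- the approximation `η = |ρ − r|`
  obtain ⟨η, hηdef⟩ : ∃ η : ℝ, η = |ρ - r| := ⟨_, rfl⟩
  rw [← hηdef, ← hQ] at hη
  have hη0 : 0 < η := by rw [hηdef]; exact abs_pos.mpr (sub_ne_zero.mpr hρr)
  have hη7 : η < Real.exp (-(Q ^ 7)) := by
    refine hη.trans_le (Real.exp_le_exp.mpr ?_)
    rw [neg_le_neg_iff]
    exact pow_le_pow_right₀ hQ1 hq7
  have hη1 : η < 1 := by
    refine hη7.trans_le ?_
    rw [← Real.exp_zero]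
    exact Real.exp_le_exp.mpr (by rw [neg_nonpos]; positivity)
  have hηδ : η < δ₁ := eta_lt_delta hQ1 hδ₁ (by rw [hQ]; exact_mod_cast hqδ) hη7
  -- `|r| ≤ |ρ| + 1`, `|p| ≤ (|ρ| + 1) q`
  have hrabs : |(r : ℝ)| ≤ |ρ| + 1 := by
    have h1 : |(r : ℝ)| ≤ |ρ| + |ρ - r| := by
      have := abs_sub_abs_le_abs_sub (r : ℝ) ρ
      rw [abs_sub_comm] at this
      linarith
    rw [← hηdef] at h1
    linarith
  have hpabs : |(r.num : ℝ)| ≤ (|ρ| + 1) * Q := by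
    have e : (r : ℝ) = (r.num : ℝ) / (r.den : ℝ) := by exact_mod_cast (Rat.num_div_den r).symm
    have h := hrabs
    rw [e, abs_div, Nat.abs_cast, div_le_iff₀ (by exact_mod_cast hqpos : (0 : ℝ) < r.den), ← hQ] at h
    exact h
  -- the family `G` and the eliminant `S`
  obtain ⟨G, hGdef⟩ : ∃ G : Fin (K + 1) → ℤ[X], G = torG P D r.num r.den K := ⟨_, rfl⟩
  have hGN : ∀ k, (G k).natDegree ≤ N := fun k =>
    hGdef ▸ natDegree_torG_le P D r.num r.den K hN k
  obtain ⟨S, hSdef⟩ : ∃ S : ℤ[X], S = resPoly (cyclotomic r.den ℤ) G N := ⟨_, rfl⟩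
  have hs₀K : s₀ 1 ≤ K := hK s₀ hs₀
  have hne : ∀ b ∈ ((cyclotomic r.den ℤ).map (Int.castRingHom ℂ)).roots, conjFactor G b ≠ 0 := by
    intro b hb
    rw [roots_cyclotomic_map hqpos] at hb
    have hb' : IsPrimitiveRoot b r.den := (mem_primitiveRoots hqpos).mp (Finset.mem_def.mpr hb)
    rw [hGdef]
    exact conjFactor_torG_ne_zero D r.num r.den hD hN hs₀ hs₀K r rfl rfl hqden hqN hb'
  have hS0 : S ≠ 0 := hSdef ▸ resPoly_ne_zero' _ (cyclotomic_ne_zero _ ℤ) G hGN hne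
  -- (L) the lower bound from `π`'s transcendence measure
  obtain ⟨d, hd⟩ : ∃ d : ℕ, d = r.den * K + 1 := ⟨_, rfl⟩
  have hd1 : 1 ≤ d := by omega
  have hdegS : S.natDegree ≤ d := by
    rw [hSdef, hd]
    exact (natDegree_resPoly_cyclotomic_le G hGN r.den).trans (Nat.le_succ _)
  have hdQ : (d : ℝ) ≤ ((K : ℝ) + 1) * Q := by
    rw [hd, hQ]; push_cast; nlinarith
  have hrelLen : relLen G ≤ A * Q ^ D := by
    rw [hGdef]
    refine (relLen_torG_le P D r.num r.den hD hN).trans ?_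
    rw [hA, ← hQ]
    have h1 : (|(r.num : ℝ)| + Q) ^ D ≤ ((|ρ| + 2) * Q) ^ D := by
      apply pow_le_pow_left₀ (by positivity)
      linarith
    rw [mul_pow] at h1
    have hc0 : (0 : ℝ) ≤ (cP P : ℝ) := by linarith
    calc ((K : ℝ) + 1) * (((N : ℝ) + 1) * ((cP P : ℝ) * (|(r.num : ℝ)| + Q) ^ D))
        ≤ ((K : ℝ) + 1) * (((N : ℝ) + 1) * ((cP P : ℝ) * ((|ρ| + 2) ^ D * Q ^ D))) := by
          gcongr
      _ = ((K : ℝ) + 1) * (((N : ℝ) + 1) * ((cP P : ℝ) * (|ρ| + 2) ^ D)) * Q ^ D := by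
          ring
  have hAQ1 : 1 ≤ A * Q ^ D := one_le_mul_of_one_le_of_one_le hA1 (one_le_pow₀ hQ1)
  have hlenS : (len S : ℝ) ≤ 2 ^ d * (A * Q ^ D) ^ r.den := by
    refine (len_le_two_pow_mul_mahlerMeasure S).trans ?_
    have h1 : (2 : ℝ) ^ S.natDegree ≤ 2 ^ d := pow_le_pow_right₀ (by norm_num) hdegS
    have h2 : (S.map (Int.castRingHom ℂ)).mahlerMeasure ≤ (A * Q ^ D) ^ r.den := by
      rw [hSdef]
      refine (mahlerMeasure_resPoly_cyclotomic_le G hGN hqpos).trans ?_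
      calc relLen G ^ r.den.totient ≤ (A * Q ^ D) ^ r.den.totient :=
            pow_le_pow_left₀ (relLen_nonneg G) hrelLen _
        _ ≤ (A * Q ^ D) ^ r.den := pow_le_pow_right₀ hAQ1 (Nat.totient_le _)
    exact mul_le_mul h1 h2 (mahlerMeasure_nonneg _) (by positivity)
  obtain ⟨Λ, hΛ⟩ : ∃ Λ : ℝ, Λ = 2 ^ d * (A * Q ^ D) ^ r.den + 3 := ⟨_, rfl⟩
  have hΛlen : (len S : ℝ) + 3 ≤ Λ := by rw [hΛ]; linarith
  have hlow := pi_measure S hS0 hd1 hdegS hΛlen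
  -- (L') the exponent is at most `A₃ Q⁴`
  have hlogΛ : Real.log Λ ≤ A₂ * Q ^ 2 := by
    rw [hΛ, hA₂]
    exact log_Lambda_le hQ1 hA1 (by linarith) hD0 (Nat.cast_nonneg d) hdQ hQ.symm rfl rfl
  have hlogΛ0 : 0 ≤ Real.log Λ := by
    refine Real.log_nonneg ?_
    rw [hΛ]
    have : (0 : ℝ) ≤ 2 ^ d * (A * Q ^ D) ^ r.den := by positivity
    linarith
  have hE : 2 * 10 ^ 6 * (d : ℝ) * (Real.log Λ + d * Real.log d) * (1 + Real.log d) ≤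
      A₃ * Q ^ 4 := by
    rw [hA₃]
    exact exponent_le hQ1 (by linarith) (by exact_mod_cast hd1) hdQ hA₂0 hlogΛ0 hlogΛ
  have hlow' : Real.exp (-(A₃ * Q ^ 4)) ≤ ‖aeval (Real.pi : ℂ) S‖ :=
    le_trans (Real.exp_le_exp.mpr (by linarith)) hlow
  -- (U) the upper bound: the product over primitive roots
  obtain ⟨y, hy⟩ : ∃ y : ℂ, y = cexp (2 * Real.pi * I * (r : ℂ)) := ⟨_, rfl⟩
  have hyprim : IsPrimitiveRoot y r.den := hy ▸ isPrimitiveRoot_exp_rat r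
  have hymem : y ∈ primitiveRoots r.den ℂ := (mem_primitiveRoots hqpos).mpr hyprim
  have hfac : ∀ b : ℂ, (conjFactor G b).eval (Real.pi : ℂ) =
      (r.den : ℂ) ^ D * MvPolynomial.aeval ![((r.num : ℂ) / r.den), (Real.pi : ℂ), b] P := by
    intro b; rw [hGdef]; exact eval_conjFactor_torG P D r.num r.den hD hK hq0 b _
  have hrC : ((r : ℝ) : ℂ) = (r.num : ℂ) / r.den := by
    rw [Complex.ofReal_ratCast, Rat.cast_def]
  have hval : aeval (Real.pi : ℂ) S =
      ∏ b ∈ primitiveRoots r.den ℂ, (conjFactor G b).eval (Real.pi : ℂ) := by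
    rw [hSdef]; exact aeval_resPoly_cyclotomic G hGN hqpos _
  have hnormq : ‖((r.den : ℂ)) ^ D‖ = Q ^ D := by rw [norm_pow, Complex.norm_natCast, hQ]
  -- the special factor
  have hyfac : ‖(conjFactor G y).eval (Real.pi : ℂ)‖ ≤ Q ^ D * (Kl * η) := by
    rw [hfac y, norm_mul, hnormq]
    refine mul_le_mul_of_nonneg_left ?_ (by positivity)
    have e1 : MvPolynomial.aeval ![((r.num : ℂ) / r.den), (Real.pi : ℂ), y] P = torF P r := by
      rw [torF_eq_aeval, hy, Complex.ofReal_ratCast, ← Rat.cast_def]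
    rw [e1, ← sub_zero (torF P r), ← hFρ]
    have h1 : |(r : ℝ) - ρ| < δ₁ := by rw [abs_sub_comm, ← hηdef]; exact hηδ
    have h2 := hlip r h1
    rw [abs_sub_comm, ← hηdef] at h2
    exact h2
  -- the other factors
  have hofac : ∀ b ∈ primitiveRoots r.den ℂ,
      ‖(conjFactor G b).eval (Real.pi : ℂ)‖ ≤ Q ^ D * B' := by
    intro b hb
    have hb' : IsPrimitiveRoot b r.den := (mem_primitiveRoots hqpos).mp hb
    rw [hfac b, norm_mul, hnormq]
    refine mul_le_mul_of_nonneg_left (le_trans ?_ hBB') (by positivity)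
    rw [hB]
    refine norm_mvaeval_le P _ ?_ ?_ ?_
    · show ‖((r.num : ℂ) / r.den)‖ ≤ |ρ| + 1
      rw [← hrC, Complex.norm_real, Real.norm_eq_abs]; exact hrabs
    · show ‖(Real.pi : ℂ)‖ ≤ 4
      rw [Complex.norm_real, Real.norm_eq_abs, abs_of_pos Real.pi_pos]
      linarith [Real.pi_lt_four]
    · show ‖b‖ ≤ 1
      rw [hb'.norm'_eq_one hq0]
  have hcard : (primitiveRoots r.den ℂ).card = r.den.totient := hyprim.card_primitiveRoots
  have hQB1 : 1 ≤ Q ^ D * B' := one_le_mul_of_one_le_of_one_le (one_le_pow₀ hQ1) hB'1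
  have hup : ‖aeval (Real.pi : ℂ) S‖ ≤ (Q ^ D * B') ^ r.den * (Q ^ D * (Kl * η)) := by
    rw [hval, norm_prod, ← Finset.mul_prod_erase _ _ hymem, mul_comm]
    refine mul_le_mul ?_ hyfac (norm_nonneg _) (by positivity)
    have h1 : ∏ b ∈ (primitiveRoots r.den ℂ).erase y, ‖(conjFactor G b).eval (Real.pi : ℂ)‖ ≤
        ∏ _b ∈ (primitiveRoots r.den ℂ).erase y, (Q ^ D * B') :=
      Finset.prod_le_prod (fun _ _ => norm_nonneg _)
        fun b hb => hofac b (Finset.mem_of_mem_erase hb)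
    refine h1.trans ?_
    rw [Finset.prod_const]
    refine pow_le_pow_right₀ hQB1 ?_
    calc ((primitiveRoots r.den ℂ).erase y).card ≤ (primitiveRoots r.den ℂ).card :=
          Finset.card_erase_le
      _ = r.den.totient := hcard
      _ ≤ r.den := Nat.totient_le _
  -- (U') at most `exp(A₁ Q²) η`
  have hup' : (Q ^ D * B') ^ r.den * (Q ^ D * (Kl * η)) ≤ Real.exp (A₁ * Q ^ 2) * η := by
    rw [hA₁]; exact upper_exp hQ.symm hQ1 hB'1 hKl0 hη0.le
  -- (E) endgame
  have hchain : Real.exp (-(A₃ * Q ^ 4)) < Real.exp (A₁ * Q ^ 2) * Real.exp (-(Q ^ 7)) := by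
    calc Real.exp (-(A₃ * Q ^ 4)) ≤ ‖aeval (Real.pi : ℂ) S‖ := hlow'
      _ ≤ (Q ^ D * B') ^ r.den * (Q ^ D * (Kl * η)) := hup
      _ ≤ Real.exp (A₁ * Q ^ 2) * η := hup'
      _ < Real.exp (A₁ * Q ^ 2) * Real.exp (-(Q ^ 7)) :=
          mul_lt_mul_of_pos_left hη7 (Real.exp_pos _)
  rw [← Real.exp_add, Real.exp_lt_exp] at hchain
  have hQA : A₁ + A₃ + 1 ≤ Q := by
    have hc : (⌈A₁ + A₃⌉₊ : ℝ) + 1 ≤ Q := by rw [hQ]; exact_mod_cast hqA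
    linarith [Nat.le_ceil (A₁ + A₃)]
  exact torEndgame hQ1 hA₁0 hA₃0 hQA hchain

/-- **Torsion extraction, algebraic form**: `ρ, π, e^{2πiρ}` are algebraically independent over `ℚ`
for every hyper-Liouville real `ρ`.  Hypothesis-free (the `π` measure used is PROVED in the tree). -/
theorem algebraicIndependent_torsion {ρ : ℝ} (hρ : HyperLiouville ρ) :
    AlgebraicIndependent ℚ ![(ρ : ℂ), (Real.pi : ℂ), cexp (2 * Real.pi * I * ρ)] :=
  algebraicIndependent_of_forall_int fun G hG => torsion_aeval_ne_zero hρ G hG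

end HyperCell

end Summit.Schanuel.Schanuel.Theorems.RootDecomp1KHyper
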